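import Mathlib
import Summits.NavierStokesRegularity.NavierStokesRegularity.Theorems.WakeRatchetTailRatchetDyadicBlowup
import Summits.NavierStokesRegularity.NavierStokesRegularity.Theorems.WakeRatchetTailRatchetDyadicLowerRate
import HarnessLib

/-!
# `WakeRatchet.TailRatchet` (stmt-NavierStokesRegularity-21808), door D4′ — Cauchy side:
# the non-negative dyadic blow-up is EXACTLY TYPE-I (two-sided scale-critical rate at the maximal time)

Def-free corollary file.  MODEL lattice ODEs only (the scalar dyadic chain `Ẋₙ = Λⁿ⁻¹ Xₙ₋₁² − Λⁿ Xₙ Xₙ₊₁`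
of Tao 2016 §1.2 / §4, `m = 1`); nothing here is a statement about the Navier–Stokes equations;
stmt-21808 is neither proved nor refuted here and no stub of skeleton d00b85951d7c is closed.

Combining the maximal regular solution of `WakeRatchetDyadicCauchy.dyadic_blowup` (finite blow-up time
`T*`, blow-up alternative) with the tree's two a-priori rates — the type-I upper rate
(`WakeRatchetDyadicPositivity.frame_bound_of_nonneg_data`, from `typeI_dyadic`) and the lower rate
`WakeRatchetDyadicLowerRate.lower_rate_dyadic` (whose blow-up hypothesis is exactly the blow-up
alternative) — gives:

* `dyadic_blowup_typeI` — for every `Λ > 1` and every non-negative datum in `ℓ^∞_Λ` with a positive shell,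
  along the maximal regular solution on `(−δ₀, T*)`:
  `1/((Λ+Λ⁻¹)(T* − t)) ≤ sup_n Λⁿ|Xₙ(t)|` at every `t ∈ (−δ₀, T*)` (in the form: any bound `β` of the
  frame at time `t` has `1 ≤ (Λ+Λ⁻¹)β(T* − t)`), and `ΛⁿXₙ(t)(T* − t) ≤ 2Λ²/(Λ−1)²` for `t ∈ [0, T*)`:
  the blow-up of the scale-critical norm is EXACTLY of type I — the recentred frames
  `W_n(σ) = Λⁿ(T* − t)Xₙ(t)` are uniformly bounded AND uniformly non-degenerate («some shell is active at
  every instant»), the two frame-side inputs of the extraction of door D4′.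

HONEST FRAMING: packaging of tree results; the analytic inputs (M), (D), (Q) of door D4′ are NOT
addressed; rung 0.
-/

noncomputable section

set_option linter.dupNamespace false

namespace Summit.NavierStokesRegularity.NavierStokesRegularity.Theorems

namespace WakeRatchetDyadicCauchy

open Set Filter Topology

/-- **THE NON-NEGATIVE DYADIC BLOW-UP IS EXACTLY TYPE-I.**  Let `Λ > 1` and let the datum be
non-negative with `sup_n Λⁿ|X⁰ₙ| ≤ R` and one shell `X⁰_M > 0`; `δ₀ = 1/((Λ+Λ⁻¹)(R+1)² + 1)`.  There are
`T* ∈ [δ₀, 2Λ²/((Λ−1)² Λᴹ X⁰_M)]` and a solution `X` of the lattice on `(−δ₀, T*)` through the datum,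
regular below `T*`, non-negative on `[0, T*)`, with
(upper rate) `ΛⁿXₙ(t)(T* − t) ≤ 2Λ²/(Λ−1)²` for all `n` and `t ∈ [0, T*)`, and
(lower rate) for every `t ∈ (−δ₀, T*)` and every `β > 0` bounding the frame at `t` (`Λⁿ|Xₙ(t)| ≤ β` for
all `n`): `1 ≤ (Λ + Λ⁻¹)·β·(T* − t)`.
[cite: Tao2016AveragedNS, §1.2 (dyadic model: finite time blow-up, Katz–Pavlović / Cheskidov), §4 Lemma 4.1 (4.8) with `m = 1`; elementary] -/
theorem dyadic_blowup_typeI {Λ R : ℝ} (hΛ : 1 < Λ) (hR : 0 ≤ R) {X₀ : ℤ → ℝ}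
    (hX₀ : ∀ n : ℤ, |Λ ^ n * X₀ n| ≤ R) (hpos : ∀ n : ℤ, 0 ≤ X₀ n) {M : ℤ} (hM : 0 < X₀ M) :
    ∃ Tstar : ℝ, 1 / ((Λ + Λ⁻¹) * (R + 1) ^ 2 + 1) ≤ Tstar ∧
      Tstar ≤ 2 * Λ ^ 2 / ((Λ - 1) ^ 2 * (Λ ^ M * X₀ M)) ∧
    ∃ X : ℤ → ℝ → ℝ, (∀ n : ℤ, X n 0 = X₀ n) ∧
      (∀ n : ℤ, ∀ t ∈ Ioo (-(1 / ((Λ + Λ⁻¹) * (R + 1) ^ 2 + 1))) Tstar,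
        HasDerivAt (X n) (Λ ^ (n - 1) * X (n - 1) t ^ 2 - Λ ^ n * X n t * X (n + 1) t) t) ∧
      (∀ T', T' < Tstar → ∃ B : ℝ, ∀ n : ℤ,
        ∀ t ∈ Ioo (-(1 / ((Λ + Λ⁻¹) * (R + 1) ^ 2 + 1))) T', |Λ ^ n * X n t| ≤ B) ∧
      (∀ n : ℤ, ∀ t ∈ Ico 0 Tstar, 0 ≤ X n t) ∧
      (∀ n : ℤ, ∀ t ∈ Ico 0 Tstar, Λ ^ n * X n t * (Tstar - t) ≤ 2 * Λ ^ 2 / (Λ - 1) ^ 2) ∧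
      (∀ t ∈ Ioo (-(1 / ((Λ + Λ⁻¹) * (R + 1) ^ 2 + 1))) Tstar, ∀ β : ℝ, 0 < β →
        (∀ n : ℤ, |Λ ^ n * X n t| ≤ β) → 1 ≤ (Λ + Λ⁻¹) * β * (Tstar - t)) := by
  have hΛ0 : 0 < Λ := by linarith
  obtain ⟨Tstar, hδT, hTb, X, h0, hlaw, hreg, hnonneg, hupper, hunb⟩ :=
    dyadic_blowup hΛ hR hX₀ hpos hM
  refine ⟨Tstar, hδT, hTb, X, h0, hlaw, hreg, hnonneg, hupper, fun t ht β hβ hb => ?_⟩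
  -- the blow-up alternative of the maximal solution is the blow-up hypothesis of the lower rate
  have hblow : ∀ B : ℝ, ∃ n : ℤ, ∃ t ∈ Ioo (-(1 / ((Λ + Λ⁻¹) * (R + 1) ^ 2 + 1))) Tstar,
      B < |Λ ^ n * X n t| := by
    intro B
    obtain ⟨n, t, ht, hBt⟩ := hunb B
    have hδ : 0 < 1 / ((Λ + Λ⁻¹) * (R + 1) ^ 2 + 1) := by
      have : 0 < Λ⁻¹ := inv_pos.2 hΛ0
      positivity
    refine ⟨n, t, ⟨by linarith [ht.1], ht.2⟩, hBt.trans_le (le_abs_self _)⟩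
  exact WakeRatchetDyadicLowerRate.lower_rate_dyadic hΛ0 hlaw hreg hblow ht hβ hb

end WakeRatchetDyadicCauchy

end Summit.NavierStokesRegularity.NavierStokesRegularity.Theorems

end
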